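import Literature.Computability.AlgebraicComplexity.ArithCircuitProofs
import Literature.Computability.AlgebraicComplexity.StandardFamiliesProofs
import Summits.ValiantsHypothesis.ValiantsHypothesis.Theorems.DivisionGapPerDivisionHardStubJssContractionB
import Summits.ValiantsHypothesis.ValiantsHypothesis.Theorems.DivisionGapPerCofactorDegreeReductionStubAdditiveCreation
import Summits.ValiantsHypothesis.ValiantsHypothesis.Theorems.DivisionGapPerCofactorDegreeReductionStubBinaryFormCollapse
import Summits.ValiantsHypothesis.ValiantsHypothesis.Theorems.DivisionGapPerCofactorDegreeReductionStubAntipodalRatioRoot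
import Summits.ValiantsHypothesis.ValiantsHypothesis.Theorems.DivisionGapPerCofactorDegreeReductionStubRealNullstellensatzPer

/-!
# Crux `DivisionGap.PerCofactorDegreeReduction` (stmt-ValiantsHypothesis-15046), line `Sketch` —
# corollaries of the constants principle (cycle 6): the two-light-gate heavy part, uniqueness of
# the antipodal ratio, sterile difference pairs, descent of definite forms, repeated squaring

Sorry-free consequences of the c5 stubs `stub_binaryFormCollapse`, `stub_antipodalRatioRoot`,
`stub_realNullstellensatzPer` (all landed), recorded as tree theorems so that later seats and the
disprover can import them instead of re-deriving them inside the crux workfile: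

* `twoGateHeavyPart_K1` — **K1 on two-gate heavy parts, complete**: from ANY nonnegative binary-form
  relation `per_n ∣ Σᵢ cᵢ uⁱ u'^{N−i}` a nonzero nonnegative `A ∈ (per_n)` with
  `deg A ≤ max (deg u) (deg u')`, `L(A) ≤ L u + L u' + 2`, independent of `N`.
* `antipodalRatio_unique` — the ratio `γ` of an antipodal pair `u + γ u' ∈ (per_n)` is unique.
* `differencePair_sterile` — if `u^p ≡ μ u'^q (mod per_n)` with `μ > 0` then no nonzero
  nonnegative binary form in `(u^p, u'^q)` lies in `(per_n)`.
* `definiteFormDescent` — `Φ(F₁,…,F_m) ∈ (per_n)` with `Φ` vanishing on `ℝ^m` only at `0` forces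
  every `Fᵢ ∈ (per_n)` (generalises `stub_squareDescent`).
* `complexity_pow_le_log` — repeated squaring in the tree's model: `L(f^d) ≤ T · (L f + 2)` for
  `d < 2^T`, any semiring-`ℝ≥0` polynomial (the enemy's weapon made quantitative; c4, landed here).

Line lead prover-line-stmt-ValiantsHypothesis-15046-c5-0, cycle 6 (2026-08-17).  No definitions, no
named facts; Mathlib + tree only.
-/

noncomputable section

-- `Summit.ValiantsHypothesis.ValiantsHypothesis.…` is the tree's mandated single-conjunct layout
-- (Problem = Summit), so the duplicated namespace component is intended.
set_option linter.dupNamespace false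

namespace Summit.ValiantsHypothesis.ValiantsHypothesis.Theorems.DivisionGap.PerCofactorDegreeReduction.ConstantsCorollaries

open MvPolynomial Literature.Computability.AlgebraicComplexity
open Summit.ValiantsHypothesis.ValiantsHypothesis.Theorems.DivisionGap.PerCofactorDegreeReduction.BinaryFormCollapse
  (stub_binaryFormCollapse)
open Summit.ValiantsHypothesis.ValiantsHypothesis.Theorems.DivisionGap.PerCofactorDegreeReduction.AntipodalRatioRoot
  (stub_antipodalRatioRoot)
open Summit.ValiantsHypothesis.ValiantsHypothesis.Theorems.DivisionGap.PerCofactorDegreeReduction.RealNullstellensatzPer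
  (stub_realNullstellensatzPer)
open scoped NNReal BigOperators

/-- **K1 on two-gate heavy parts, complete.**  From ANY nonnegative binary-form relation
`per_n ∣ Σᵢ cᵢ uⁱ u'^{N−i}` (`c ≥ 0`, `c ≠ 0`; `u, u' ≥ 0` not in `(per_n)`, `n ≥ 1`) a nonzero
nonnegative `A ∈ (per_n)` with `deg A ≤ max (deg u) (deg u')` and `L(A) ≤ L u + L u' + 2` —
independent of `N` and of the coefficients: `A := u + γ u'` from `stub_binaryFormCollapse`.
[folklore] -/
theorem twoGateHeavyPart_K1 (n N : ℕ) (hn : 1 ≤ n)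
    (u u' : MvPolynomial (Fin n × Fin n) ℝ≥0)
    (hu : ¬ perPoly (Fin n) ℝ ∣ MvPolynomial.map NNReal.toRealHom u)
    (hu' : ¬ perPoly (Fin n) ℝ ∣ MvPolynomial.map NNReal.toRealHom u')
    (c : Fin (N + 1) → ℝ≥0) (hc : c ≠ 0)
    (hdvd : perPoly (Fin n) ℝ ∣ MvPolynomial.map NNReal.toRealHom
      (∑ i : Fin (N + 1), c i • (u ^ (i : ℕ) * u' ^ (N - (i : ℕ))))) :
    ∃ A : MvPolynomial (Fin n × Fin n) ℝ≥0, A ≠ 0 ∧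
      perPoly (Fin n) ℝ ∣ MvPolynomial.map NNReal.toRealHom A ∧
      A.totalDegree ≤ max u.totalDegree u'.totalDegree ∧
      complexity A ≤ complexity u + complexity u' + 2 := by
  obtain ⟨γ, _hγ, hA⟩ := stub_binaryFormCollapse n N hn u u' hu hu' c hc hdvd
  have hu0 : u ≠ 0 := fun h0 => hu (by rw [h0, map_zero]; exact dvd_zero _)
  refine ⟨u + γ • u', ?_, hA, ?_, ?_⟩
  · intro h0
    apply hu0
    ext m
    have hm := congr_arg (coeff m) h0
    rw [coeff_add, coeff_zero] at hm
    rw [coeff_zero]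
    exact_mod_cast (add_eq_zero.mp hm).1
  · exact (totalDegree_add _ _).trans (max_le_max le_rfl (totalDegree_smul_le _ _))
  · calc complexity (u + γ • u') ≤ complexity u + complexity (γ • u') + 1 :=
          complexity_add_le_holds _ _
      _ ≤ complexity u + complexity u' + 2 := by
          have := complexity_smul_le_holds γ u'
          omega

/-- **Uniqueness of the antipodal ratio.**  If `per_n ∣ u + γu'` and `per_n ∣ u + γ'u'` with
`per_n ∤ u'` (`n ≥ 1`) then `γ = γ'` (`stub_antipodalRatioRoot` with the linear relation
`γ' · U⁰U'¹ + 1 · U¹U'⁰`). [folklore] -/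
theorem antipodalRatio_unique (n : ℕ) (hn : 1 ≤ n)
    (u u' : MvPolynomial (Fin n × Fin n) ℝ≥0)
    (hu' : ¬ perPoly (Fin n) ℝ ∣ MvPolynomial.map NNReal.toRealHom u')
    (γ γ' : ℝ≥0) (hγ : perPoly (Fin n) ℝ ∣ MvPolynomial.map NNReal.toRealHom (u + γ • u'))
    (hγ' : perPoly (Fin n) ℝ ∣ MvPolynomial.map NNReal.toRealHom (u + γ' • u')) :
    γ = γ' := by
  have key := stub_antipodalRatioRoot n 1 hn u u' hu' γ hγ ![(γ' : ℝ), 1] ?_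
  · have h2 : (γ' : ℝ) + -(γ : ℝ) = 0 := by
      simpa [Fin.sum_univ_two] using key
    have h3 : (γ : ℝ) = γ' := by linarith
    exact_mod_cast h3
  · have hmap : MvPolynomial.map NNReal.toRealHom (u + γ' • u') =
        ∑ i : Fin (1 + 1), C ((![(γ' : ℝ), 1] : Fin (1 + 1) → ℝ) i) *
          (MvPolynomial.map NNReal.toRealHom u ^ (i : ℕ) *
            MvPolynomial.map NNReal.toRealHom u' ^ (1 - (i : ℕ))) := by
      simp only [map_add, MvPolynomial.smul_eq_C_mul, map_mul, map_C]
      simp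
      ring
    rw [← hmap]
    exact hγ'

/-- **Difference pairs are sterile.**  If `per_n ∣ U^p − μ U'^q` with `μ > 0` (a DIFFERENCE pair
on the powers; `u, u' ≥ 0` not in `(per_n)`, `n ≥ 1`), then NO nonzero nonnegative binary form in
`(u^p, u'^q)` lies in `(per_n)`: such a form would give an antipodal pair `U^p + γ U'^q ∈ (per_n)`
(`stub_binaryFormCollapse` on `u^p, u'^q`), and subtracting, `(γ + μ) U'^q ∈ (per_n)`, i.e.
`per_n ∣ u'`. [folklore] -/
theorem differencePair_sterile (n N p q : ℕ) (hn : 1 ≤ n)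
    (u u' : MvPolynomial (Fin n × Fin n) ℝ≥0)
    (hu : ¬ perPoly (Fin n) ℝ ∣ MvPolynomial.map NNReal.toRealHom u)
    (hu' : ¬ perPoly (Fin n) ℝ ∣ MvPolynomial.map NNReal.toRealHom u')
    (μ : ℝ) (hμ : 0 < μ)
    (hdiff : perPoly (Fin n) ℝ ∣ MvPolynomial.map NNReal.toRealHom u ^ p -
      C μ * MvPolynomial.map NNReal.toRealHom u' ^ q)
    (c : Fin (N + 1) → ℝ≥0) (hc : c ≠ 0) :
    ¬ perPoly (Fin n) ℝ ∣ MvPolynomial.map NNReal.toRealHom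
      (∑ i : Fin (N + 1), c i • ((u ^ p) ^ (i : ℕ) * (u' ^ q) ^ (N - (i : ℕ)))) := by
  intro hdvd
  have hprime :=
    Summit.ValiantsHypothesis.ValiantsHypothesis.Theorems.DivisionGap.PerCofactorDegreeReduction.AdditiveCreation.perPoly_prime
      (n := n) hn
  have hup : ¬ perPoly (Fin n) ℝ ∣ MvPolynomial.map NNReal.toRealHom (u ^ p) := by
    rw [map_pow]
    exact fun h => hu (hprime.dvd_of_dvd_pow h)
  have hu'q : ¬ perPoly (Fin n) ℝ ∣ MvPolynomial.map NNReal.toRealHom (u' ^ q) := by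
    rw [map_pow]
    exact fun h => hu' (hprime.dvd_of_dvd_pow h)
  obtain ⟨γ, _hγ, hanti⟩ := stub_binaryFormCollapse n N hn (u ^ p) (u' ^ q) hup hu'q c hc hdvd
  have hanti' : perPoly (Fin n) ℝ ∣ MvPolynomial.map NNReal.toRealHom u ^ p +
      C (γ : ℝ) * MvPolynomial.map NNReal.toRealHom u' ^ q := by
    have hmap : MvPolynomial.map NNReal.toRealHom (u ^ p + γ • u' ^ q) =
        MvPolynomial.map NNReal.toRealHom u ^ p +
          C (γ : ℝ) * MvPolynomial.map NNReal.toRealHom u' ^ q := by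
      simp only [map_add, map_pow, MvPolynomial.smul_eq_C_mul, map_mul, map_C]
      rfl
    rwa [hmap] at hanti
  have hkey : perPoly (Fin n) ℝ ∣ C ((γ : ℝ) + μ) * MvPolynomial.map NNReal.toRealHom u' ^ q := by
    have := dvd_sub hanti' hdiff
    have hring : MvPolynomial.map NNReal.toRealHom u ^ p +
          C (γ : ℝ) * MvPolynomial.map NNReal.toRealHom u' ^ q -
        (MvPolynomial.map NNReal.toRealHom u ^ p - C μ * MvPolynomial.map NNReal.toRealHom u' ^ q) =
        C ((γ : ℝ) + μ) * MvPolynomial.map NNReal.toRealHom u' ^ q := by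
      rw [C_add]
      ring
    rwa [hring] at this
  have hpos : (γ : ℝ) + μ ≠ 0 := by
    have : (0 : ℝ) ≤ γ := γ.2
    linarith
  have hunit : IsUnit (C ((γ : ℝ) + μ) : MvPolynomial (Fin n × Fin n) ℝ) :=
    (isUnit_iff_ne_zero.mpr hpos).map C
  rcases hprime.dvd_or_dvd hkey with h1 | h2
  · exact hprime.not_unit (isUnit_of_dvd_unit h1 hunit)
  · exact hu' (by simpa [map_pow] using hprime.dvd_of_dvd_pow h2)

/-- **Definite forms descend.**  If `Φ ∈ ℝ[y₁..y_m]` vanishes on `ℝ^m` only at `0` (e.g. a positive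
definite form) and `Φ(F₁, …, F_m) ∈ (per_n)` for real polynomials `Fᵢ` (`n ≥ 1`), then every
`Fᵢ ∈ (per_n)`: at each real zero `x` of `per_n`, `Φ(F(x)) = 0` forces `F(x) = 0`, and `(per_n)` is
a real ideal (`stub_realNullstellensatzPer`).  `stub_squareDescent` is `Φ = Σ yᵢ²`. [folklore] -/
theorem definiteFormDescent (n m : ℕ) (hn : 1 ≤ n) (Φ : MvPolynomial (Fin m) ℝ)
    (hΦ : ∀ y : Fin m → ℝ, MvPolynomial.eval y Φ = 0 → y = 0)
    (F : Fin m → MvPolynomial (Fin n × Fin n) ℝ)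
    (h : perPoly (Fin n) ℝ ∣ MvPolynomial.aeval F Φ) (i : Fin m) :
    perPoly (Fin n) ℝ ∣ F i := by
  refine stub_realNullstellensatzPer n hn (F i) fun x hx => ?_
  obtain ⟨Q, hQ⟩ := h
  have h1 : MvPolynomial.eval x (MvPolynomial.aeval F Φ) = 0 := by
    rw [hQ, map_mul, hx, zero_mul]
  have h2 : MvPolynomial.eval x (MvPolynomial.aeval F Φ) =
      MvPolynomial.eval (fun j => MvPolynomial.eval x (F j)) Φ := by
    rw [MvPolynomial.aeval_eq_bind₁]
    change MvPolynomial.eval₂Hom (RingHom.id ℝ) x (MvPolynomial.bind₁ F Φ) = _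
    rw [MvPolynomial.eval₂Hom_bind₁]
    rfl
  have h3 := hΦ _ (h2 ▸ h1)
  have := congr_fun h3 i
  simpa using this

/-- **Repeated squaring: `L(f^d) ≤ T·(L(f) + 2)` for `d < 2^T`.**  A power of height `2^T` of a gate
costs `O(T · L(f))` in the tree's compositional model (squaring costs one gate,
`JssContraction.complexity_mul_self_le`, plus one multiplication by `f` per bit; the sharper
`L(f) + 2T` needs an explicit shared circuit). [folklore] -/
theorem complexity_pow_le_log {σ : Type*} (f : MvPolynomial σ ℝ≥0) (T : ℕ) :
    ∀ d : ℕ, d < 2 ^ T → complexity (f ^ d) ≤ T * (complexity f + 2) := by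
  induction T with
  | zero =>
    intro d hd
    have hd0 : d = 0 := by omega
    rw [hd0, pow_zero, ← C_1, complexity_C_holds]
    exact Nat.zero_le _
  | succ T ih =>
    intro d hd
    have hhalf : d / 2 < 2 ^ T := by rw [pow_succ] at hd; omega
    have hsplit : f ^ d = f ^ (d / 2) * f ^ (d / 2) * f ^ (d % 2) := by
      rw [← pow_add, ← pow_add]
      congr 1
      omega
    have hbit : complexity (f ^ (d % 2)) ≤ complexity f := by
      rcases Nat.mod_two_eq_zero_or_one d with h | h
      · rw [h, pow_zero, ← C_1, complexity_C_holds]; exact Nat.zero_le _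
      · rw [h, pow_one]
    rw [hsplit]
    calc complexity (f ^ (d / 2) * f ^ (d / 2) * f ^ (d % 2))
        ≤ complexity (f ^ (d / 2) * f ^ (d / 2)) + complexity (f ^ (d % 2)) + 1 :=
          complexity_mul_le_holds _ _
      _ ≤ (complexity (f ^ (d / 2)) + 1) + complexity f + 1 :=
          Nat.add_le_add_right (Nat.add_le_add
            (Summit.ValiantsHypothesis.ValiantsHypothesis.Theorems.DivisionGapPerDivisionHard.JssContraction.complexity_mul_self_le _)
            hbit) 1
      _ ≤ (T * (complexity f + 2) + 1) + complexity f + 1 := by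
          have := ih (d / 2) hhalf
          omega
      _ = (T + 1) * (complexity f + 2) := by ring

end Summit.ValiantsHypothesis.ValiantsHypothesis.Theorems.DivisionGap.PerCofactorDegreeReduction.ConstantsCorollaries

end
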